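import Summits.KontsevichZagierPeriods.KontsevichZagierPeriods.Theses.AbelContraction
import Literature.NumberTheory.Transcendental.KZKernelConjectureForms

/-!
# Crux `ReductionToDimensionTwo` (stmt-KontsevichZagierPeriods-18030, route AbelContraction, rank 8) —
# line `reddim2_ladder` (birth skeleton of piece 2 of the BC2 redirect of `RealArcKernel`, stmt-12472)

  `ReductionToDimensionTwo` : every subgroup `R ≥ KZ.relations` of `KZ.FormalRep` containing `[r] − [r′]`
  for every equal-valued pair of KZ-rational representations of dimensions `≤ 2` contains `ker KZ.eval`
  (the kernel conjecture MODULO the dimension-two stratum; GPC-strength modulo the OPEN item `KZDimTwo`).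

The line is RUNG 3 of the input-dimension ladder — the only honest plan for a statement that is the period
conjecture above an open layer is to peel the next layer:

* `stub_dimThreeLayerModTwo` — LAYER 3 MODULO THE STRATUM 2: every subgroup `R ≥ KZ.relations` containing the
  equal-valued KZ-rational pairs of dimensions `≤ 2` contains the equal-valued KZ-rational pairs of dimensions
  `≤ 3`. Content: the weight-3 coincidences — Euler's `ζ(2,1) = ζ(3)` and the weight-3 double-shuffle /
  duality relations (`∫∫∫` over simplices of `dt/t`, `dt/(1−t)`), trilogarithm functional equations at
  algebraic arguments (Spence–Kummer, 22-term), `π³`/`π·ζ(2)`-type products, cubic-surface and K3-type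
  two-dimensional algebraic integrands seen as three-dimensional rational volumes — realised as move chains
  MODULO the dilogarithmic / elliptic coincidences of the stratum. Derivability of the KNOWN identities is
  attackable today (the MZV double-shuffle chains of route FurushoPentagon land in exactly this layer);
  completeness needs the transcendence theory of weight 3 that nobody has (`ζ(3) ∉ ℚ̄·π³` is open).
* `stub_reductionToDimensionThree` — the kernel conjecture modulo the dimension-THREE stratum (the next
  tail; GPC-strength modulo the strata `≤ 3`, stated openly; its plan is rung 4).

Composition `ReductionToDimensionTwo_of` is pure logic (the layer stub feeds the hypothesis of the tail
stub). Both stubs are implied by the crux (`stub₁`: layer-3 pairs lie in `ker eval`; `stub₂`: monotonicity)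
and neither gives it back by any cheap probe (bc/reddim2_stubprobe.lean), nor the summit.

No `Disproof.lean` exists for this crux (new item); negatives index: KinematicPlaneConvex only (no convexity
hypothesis anywhere here). Strength barriers `kzConjecture_implies_oddZetaAlgIndep` /
`_twoPiI_log_algIndep` / `_ellipticPeriods_algIndep` bite `stub_reductionToDimensionThree` exactly as they
bite the crux and the summit (stated openly); `stub_dimThreeLayerModTwo` claims chains only for TRUE
coincidences of weight ≤ 3 modulo weight ≤ 2 and asserts no independence.

References: M. Kontsevich, D. Zagier, *Periods* (2001), §1.2 Conjecture 1; A. Huber, S. Müller-Stach,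
*Periods and Nori Motives* (2017), Ch. 13; F. Brown, *Mixed Tate motives over ℤ* (2012) (weight
filtration of MZVs); J. Ayoub (2015).
-/

noncomputable section

open Literature.NumberTheory.Transcendental

namespace Summit.KontsevichZagierPeriods.KontsevichZagierPeriods.Cruxes.ReductionToDimensionTwo.Reddim2Ladder

/-! ## Registered stubs -/

/-- **Layer 3 modulo the stratum 2.** Every subgroup `R ≥ KZ.relations` that contains `[r] − [r′]` for
every equal-valued pair of KZ-rational representations of dimensions `≤ 2` contains `[r] − [r′]` for every
equal-valued pair of KZ-rational representations of dimensions `≤ 3`. Why it might fail: a weight-3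
coincidence (a trilogarithm identity at algebraic points, a relation among cubic-surface / K3 periods)
may need chains nobody has; completeness needs the open transcendence theory of weight 3.
[size open-problem (derivability of the known identities: XL)] [cite: KontsevichZagier2001, §1.2] -/
theorem stub_dimThreeLayerModTwo :
    ∀ R : AddSubgroup KZ.FormalRep, KZ.relations ≤ R →
      (∀ ⦃n m : ℕ⦄, n ≤ 2 → m ≤ 2 → ∀ (r : KZ.IntegralRep n) (r' : KZ.IntegralRep m),
        r.IsRational → r'.IsRational → r.value = r'.value → KZ.of r - KZ.of r' ∈ R) →
      ∀ ⦃n m : ℕ⦄, n ≤ 3 → m ≤ 3 → ∀ (r : KZ.IntegralRep n) (r' : KZ.IntegralRep m),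
        r.IsRational → r'.IsRational → r.value = r'.value → KZ.of r - KZ.of r' ∈ R := by
  sorry

/-- **The kernel conjecture modulo the dimension-three stratum** (the next tail of the ladder;
GPC-strength modulo the strata `≤ 3`, stated openly). Why it might fail: false iff some value-`0`
combination of inputs of weight `≥ 4` beyond the strata (MZVs of weight ≥ 4, Γ-products, CY periods) is
underivable even with every coincidence of dimensions `≤ 3` adjoined — and then the summit is false.
[size open-problem] [cite: KontsevichZagier2001, §1.2 Conjecture 1] -/
theorem stub_reductionToDimensionThree :
    ∀ R : AddSubgroup KZ.FormalRep, KZ.relations ≤ R →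
      (∀ ⦃n m : ℕ⦄, n ≤ 3 → m ≤ 3 → ∀ (r : KZ.IntegralRep n) (r' : KZ.IntegralRep m),
        r.IsRational → r'.IsRational → r.value = r'.value → KZ.of r - KZ.of r' ∈ R) →
      ∀ x : KZ.FormalRep, KZ.eval x = 0 → x ∈ R := by
  sorry

/-! ## The crux is the route's item verbatim (kernel-checked identification) -/

example : (∀ R : AddSubgroup KZ.FormalRep, KZ.relations ≤ R →
      (∀ ⦃n m : ℕ⦄, n ≤ 2 → m ≤ 2 → ∀ (r : KZ.IntegralRep n) (r' : KZ.IntegralRep m),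
        r.IsRational → r'.IsRational → r.value = r'.value → KZ.of r - KZ.of r' ∈ R) →
      ∀ x : KZ.FormalRep, KZ.eval x = 0 → x ∈ R) ↔
    Summit.KontsevichZagierPeriods.KontsevichZagierPeriods.Theses.AbelContraction.ReductionToDimensionTwo :=
  Iff.rfl

/-! ## Composition (sorry-free): the two stubs imply the crux BY NAME -/

/-- **`ReductionToDimensionTwo_of`**: layer 3 modulo the stratum and the reduction modulo the
dimension-three stratum imply the crux: given `R ≥ KZ.relations` containing the stratum-2 pairs, the layer
stub puts the stratum-3 pairs inside `R`, and the tail stub then puts `ker KZ.eval` inside `R`.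
[cite: KontsevichZagier2001, §1.2] -/
theorem ReductionToDimensionTwo_of :
    (∀ R : AddSubgroup KZ.FormalRep, KZ.relations ≤ R →
      (∀ ⦃n m : ℕ⦄, n ≤ 2 → m ≤ 2 → ∀ (r : KZ.IntegralRep n) (r' : KZ.IntegralRep m),
        r.IsRational → r'.IsRational → r.value = r'.value → KZ.of r - KZ.of r' ∈ R) →
      ∀ ⦃n m : ℕ⦄, n ≤ 3 → m ≤ 3 → ∀ (r : KZ.IntegralRep n) (r' : KZ.IntegralRep m),
        r.IsRational → r'.IsRational → r.value = r'.value → KZ.of r - KZ.of r' ∈ R) →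
    (∀ R : AddSubgroup KZ.FormalRep, KZ.relations ≤ R →
      (∀ ⦃n m : ℕ⦄, n ≤ 3 → m ≤ 3 → ∀ (r : KZ.IntegralRep n) (r' : KZ.IntegralRep m),
        r.IsRational → r'.IsRational → r.value = r'.value → KZ.of r - KZ.of r' ∈ R) →
      ∀ x : KZ.FormalRep, KZ.eval x = 0 → x ∈ R) →
    Summit.KontsevichZagierPeriods.KontsevichZagierPeriods.Theses.AbelContraction.ReductionToDimensionTwo :=
  fun h₃ hR₃ R hR h2 x hx => hR₃ R hR (h₃ R hR h2) x hx

/-- The crux from the stubs themselves (so that a lead closing both stubs closes the item). -/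
theorem reductionToDimensionTwo_of_stubs :
    Summit.KontsevichZagierPeriods.KontsevichZagierPeriods.Theses.AbelContraction.ReductionToDimensionTwo :=
  ReductionToDimensionTwo_of stub_dimThreeLayerModTwo stub_reductionToDimensionThree

/-! ## The stubs are strictly weaker than the crux in the cheap direction (recorded, sorry-free) -/

/-- The crux implies the layer stub: layer-3 pairs lie in `ker KZ.eval`. -/
theorem dimThreeLayerModTwo_of_crux
    (h : Summit.KontsevichZagierPeriods.KontsevichZagierPeriods.Theses.AbelContraction.ReductionToDimensionTwo) :
    ∀ R : AddSubgroup KZ.FormalRep, KZ.relations ≤ R →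
      (∀ ⦃n m : ℕ⦄, n ≤ 2 → m ≤ 2 → ∀ (r : KZ.IntegralRep n) (r' : KZ.IntegralRep m),
        r.IsRational → r'.IsRational → r.value = r'.value → KZ.of r - KZ.of r' ∈ R) →
      ∀ ⦃n m : ℕ⦄, n ≤ 3 → m ≤ 3 → ∀ (r : KZ.IntegralRep n) (r' : KZ.IntegralRep m),
        r.IsRational → r'.IsRational → r.value = r'.value → KZ.of r - KZ.of r' ∈ R := by
  intro R hR h2 n m _ _ r r' _ _ hv
  exact h R hR h2 _ (by rw [KZ.eval_of_sub_of, hv, sub_self])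

/-- The crux implies the tail stub: monotonicity of the filtration. -/
theorem reductionToDimensionThree_of_crux
    (h : Summit.KontsevichZagierPeriods.KontsevichZagierPeriods.Theses.AbelContraction.ReductionToDimensionTwo) :
    ∀ R : AddSubgroup KZ.FormalRep, KZ.relations ≤ R →
      (∀ ⦃n m : ℕ⦄, n ≤ 3 → m ≤ 3 → ∀ (r : KZ.IntegralRep n) (r' : KZ.IntegralRep m),
        r.IsRational → r'.IsRational → r.value = r'.value → KZ.of r - KZ.of r' ∈ R) →
      ∀ x : KZ.FormalRep, KZ.eval x = 0 → x ∈ R :=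
  fun R hR h3 x hx => h R hR
    (fun _ _ hn hm r r' hr hr' hv => h3 (hn.trans (by norm_num)) (hm.trans (by norm_num)) r r' hr hr' hv) x hx

end Summit.KontsevichZagierPeriods.KontsevichZagierPeriods.Cruxes.ReductionToDimensionTwo.Reddim2Ladder

end
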